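import Summits.CriticalPhenomena.PercolationContinuityZ3.Theorems.PercNearOneGluingNoHeavyQuantForestLawTreeBuilt
import Summits.CriticalPhenomena.PercolationContinuityZ3.Theorems.PercNearOneGluingNoHeavyQuantFarTreeMeanLeOne
import HarnessLib

/-!
# QUANT lane R8 — THE BRIDGE: `FAR for tree-built laws ⟹ Quant.FarTreeRow` and `LawDec.SDECConvClosed ⟹ Quant.FarTreeRow`
# (kernel composition of the law-level R8 architecture with the geometric tree row)

builds on p205010 (kernel theorem, internal audit signed; external expert review pending)

Support file (`--supports stmt-CriticalPhenomena-4575`), QUANT lane lead seat prim-quant-lead (gen 20), rung R8 of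
`run/shared/lean/prim/quant/LADDER.md`.  Theorems only, no definitions, no sorries, standard axioms.  Inputs: `ForestLaw.treeBuilt_law`
(`…QuantForestLawTreeBuilt`: the reached-relay count of a forest is `LawDec.TreeBuilt` at every floor below its marginals),
`RootDecGate.sum_mul_real_Nk_eq` (mean = Σ marginals, `…QuantFarTreeMeanLeOne`), census-2 g53's `LawDec.decAt_of_treeBuilt` (`…QuantSDEC`)
and the typer's `LawDec.tail_ge_of_decAt` (`…QuantLawDEC`).

* `LawDec.treeBuilt_row_of_sdecConvClosed` — `SDECConvClosed →` every tree-built law with `2j < mean` has `x ≤ μ{j+1..M}`.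
* **`Quant.farTreeRow_of_treeBuilt_rows`** — if every tree-built law satisfies that row, then `Quant.FarTreeRow` (for every floor
  `x < 1 − t` the forest's count law is tree-built at `x`, so `x ≤ P(N ≥ j+1)`; let `x ↑ 1 − t`).  The hypothesis is the law-level
  statement every current R8 route proves things about (census-2's SL / SDEC closure conjectures, the DEC-certificate architecture);
  no new `Prop` is introduced for it.
* **`Quant.farTreeRow_of_sdecConvClosed : LawDec.SDECConvClosed → Quant.FarTreeRow`** — the tree row of R8 is now ONE law-level
  closure conjecture away in the kernel (conditional result; `SDECConvClosed` is `@[conjecture]`, exact-LP evidence 0 / 16 689 + 327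
  pairs, census-2 g53).  HONEST STATUS: `Quant.FarTreeRow` itself remains OPEN; nothing here proves `SDECConvClosed` or DIB\*.

[this work]; architecture prim-quant-census-2 g49/g53 (this lane); product measure [cite: Grimmett1999, §1.3 p. 10]; the gluing rows
served [cite: KozmaNitzan2024, Conjecture 3 (p. 15)].
-/

noncomputable section

namespace Summit.CriticalPhenomena.PercolationContinuityZ3.Theorems

namespace Quant

/-! ### 4. The bridge theorems: FAR for tree-built laws ⟹ `Quant.FarTreeRow`; `SDECConvClosed ⟹ Quant.FarTreeRow` -/

section Bridge

open Finset MeasureTheory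
open Literature.Probability.LatticeModels
open Literature.Probability.Percolation
open scoped Classical

/-- **`SDECConvClosed` ⟹ the FAR row for every tree-built law**: a `TreeBuilt x M μ` law with `2j < mean` has
`x ≤ μ{j+1, …, M}` (census-2 g53's `decAt_of_treeBuilt` at the dominant layer `j`, then `LawDec.tail_ge_of_decAt`). [this work] -/
theorem LawDec.treeBuilt_row_of_sdecConvClosed (hC : LawDec.SDECConvClosed) {x : ℝ} {M : ℕ} {μ : ℕ → ℝ}
    (h : LawDec.TreeBuilt x M μ) (j : ℕ) (hdom : (2 * j : ℝ) < ∑ h ∈ Finset.range (M + 1), (h : ℝ) * μ h) :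
    x ≤ ∑ h ∈ Finset.Ico (j + 1) (M + 1), μ h :=
  LawDec.tail_ge_of_decAt x j M μ (LawDec.treeBuilt_sdec hC h).2.1.le (LawDec.decAt_of_treeBuilt hC h j) hdom

/-- **THE BRIDGE.**  If every tree-built law (`LawDec.TreeBuilt x M μ`: the closure of `δ₀`, `δ₁` under independent sums,
Bernoulli gating with the floor multiplied by the gate, and floor-lowering) satisfies the far-relay row
"`2j < mean ⟹ x ≤ μ{j+1, …, M}`", then `Quant.FarTreeRow` holds.  Proof: the reached-relay count of the forest is tree-built at
every floor `x < 1 − t` (`ForestLaw.treeBuilt_law`; marginals `≥ 1 − t`), its mean is `Σ_a ∏_{P a} q` (`RootDecGate.sum_mul_real_Nk_eq`),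
so `x ≤ P(N ≥ j+1)` for every such `x`, whence `1 − t ≤ P(N ≥ j+1)`. [this work] -/
theorem farTreeRow_of_treeBuilt_rows
    (H : ∀ (x : ℝ) (M : ℕ) (μ : ℕ → ℝ), LawDec.TreeBuilt x M μ → ∀ j : ℕ,
      (2 * j : ℝ) < ∑ h ∈ Finset.range (M + 1), (h : ℝ) * μ h → x ≤ ∑ h ∈ Finset.Ico (j + 1) (M + 1), μ h) :
    FarTreeRow := by
  intro m P _ htrans hchain q A j t hbudget hmarg
  -- mean of the count law = sum of the marginals
  have hmean : ∑ h ∈ Finset.range (A.card + 1), (h : ℝ) *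
      (prodBernoulli q).real {ω : Set (Fin m) | (A.filter fun a => ((P a : Finset (Fin m)) : Set (Fin m)) ⊆ ω).card = h} =
      ∑ a ∈ A, ∏ y ∈ P a, (q y : ℝ) := by
    have e := RootDecGate.sum_mul_real_Nk_eq q A P (fun _ => ()) ()
    simp only [Finset.filter_true] at e
    exact e
  -- tail of the count law = the heavy event
  have htail : ∑ h ∈ Finset.Ico (j + 1) (A.card + 1),
      (prodBernoulli q).real {ω : Set (Fin m) | (A.filter fun a => ((P a : Finset (Fin m)) : Set (Fin m)) ⊆ ω).card = h} =
      (prodBernoulli q).real {ω : Set (Fin m) | j + 1 ≤ (A.filter fun a => ((P a : Finset (Fin m)) : Set (Fin m)) ⊆ ω).card} := by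
    have key := sum_measureReal_preimage_singleton (μ := prodBernoulli q) (Finset.Ico (j + 1) (A.card + 1))
      (f := fun ω : Set (Fin m) => (A.filter fun a => ((P a : Finset (Fin m)) : Set (Fin m)) ⊆ ω).card)
      (fun _ _ => MeasurableSet.of_discrete)
    have hpre : (fun ω : Set (Fin m) => (A.filter fun a => ((P a : Finset (Fin m)) : Set (Fin m)) ⊆ ω).card) ⁻¹'
        (↑(Finset.Ico (j + 1) (A.card + 1)) : Set ℕ) =
        {ω : Set (Fin m) | j + 1 ≤ (A.filter fun a => ((P a : Finset (Fin m)) : Set (Fin m)) ⊆ ω).card} := by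
      ext ω
      simp only [Set.mem_preimage, Finset.coe_Ico, Set.mem_Ico, Set.mem_setOf_eq]
      exact ⟨fun h => h.1, fun h => ⟨h, Nat.lt_succ_of_le (Finset.card_filter_le _ _)⟩⟩
    rw [hpre] at key
    exact key
  -- some relay exists (the budget is positive)
  have hA : A.Nonempty := by
    rw [Finset.nonempty_iff_ne_empty]
    rintro rfl
    rw [Finset.sum_empty] at hbudget
    have : (0 : ℝ) ≤ 2 * j := by positivity
    linarith
  obtain ⟨a₀, ha₀⟩ := hA
  rw [RootDecGate.real_light_eq_one_sub]
  suffices key : 1 - t ≤ (prodBernoulli q).real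
      {ω : Set (Fin m) | j + 1 ≤ (A.filter fun a => ((P a : Finset (Fin m)) : Set (Fin m)) ⊆ ω).card} by linarith
  rw [← htail]
  refine le_of_forall_lt_imp_le_of_dense fun x hx => ?_
  by_cases hx0 : x ≤ 0
  · exact hx0.trans (Finset.sum_nonneg fun h _ => measureReal_nonneg)
  · have hx0' : 0 < x := lt_of_not_ge hx0
    have hfloor : ∀ a ∈ A, x < ∏ y ∈ P a, (q y : ℝ) := fun a ha => by linarith [hmarg a ha]
    have hx1 : x < 1 :=
      (hfloor a₀ ha₀).trans_le (Finset.prod_le_one (fun y _ => (q y).2.1) (fun y _ => (q y).2.2))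
    have hT := ForestLaw.treeBuilt_law q P htrans hchain A x hx0' hx1 hfloor
    exact H x A.card _ hT j (by rw [hmean]; exact hbudget)

/-- **`LawDec.SDECConvClosed ⟹ Quant.FarTreeRow`** — the R8 tree row follows in the kernel from census-2 g53's single law-level
closure conjecture (gate-stable DEC is closed under convolution), by `treeBuilt_row_of_sdecConvClosed` and the bridge.  With
`Quant.farRelayRow_tree_of_farTreeRow` this also gives the body of `Quant.FarRelayRow` for every tree-supported weight function. [this work] -/
theorem farTreeRow_of_sdecConvClosed (hC : LawDec.SDECConvClosed) : FarTreeRow :=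
  farTreeRow_of_treeBuilt_rows fun _ _ _ hT j hdom => LawDec.treeBuilt_row_of_sdecConvClosed hC hT j hdom

end Bridge

end Quant

end Summit.CriticalPhenomena.PercolationContinuityZ3.Theorems
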